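import Mathlib
import HarnessLib
import Summits.ResolutionOfSingularities.ResolutionOfSingularities.Theorems.WildQuotientsWildQuotientResolutionS1aChartRingNode
import Summits.ResolutionOfSingularities.ResolutionOfSingularities.Theorems.WildQuotientsWildQuotientResolutionS1aChartRingSigma
import Summits.ResolutionOfSingularities.ResolutionOfSingularities.Theorems.WildQuotientsWildQuotientResolutionS1aProducerStep

/-!
# S1a — the chart ring `R^w[(b T^d)⁻¹]` with its Rees bigrading and `σʼ` IS A TAME NODE (the CHART half of H3)

[OURS · L1 W4.5c · lead-1 g6] — NOT a statement of the manuscript; counted 0; AI-level work, weaker than expert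
review. Crux stmt-ResolutionOfSingularities-17941 (`WildQuotients.CyclicQuotientFourfolds`), line `s1a-logminvertex`,
stub `stub_localGame` (producer). H3 `…S1aProducerStep` (p572348) typed the one-node producer step
(`OneNodeProducerStep p` = `ChartClause ∧ CoverClause`) as a STATEMENT ONLY; this file PROVES its chart half in the
normalised form that H4cʼs `BlowupNodeAtlas` consumes after (G1c) (cover elements of bidegree `(d, 0)`, `b ∈ K d`
σ-invariant, `0 < d`):

**`chartRing_isTameNode`** — if `(B, 𝒜, σ)` is a tame node at `p` (`IsTameNode p B 𝒜 σ`, `0 < p`) and `(f, w)` is a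
homogeneous (`fᵢ ∈ 𝒜 (δ i)`), positively weighted, K1′-regular (`f` a regular sequence, `B ⧸ (f)` regular), σ-adapted
centre, then for every `σ`-invariant `b ∈ K d`, `0 < d`, the chart ring `ChartRing 𝒜 f w d b hb = R^w[(b T^d)⁻¹]`
with its Rees bigrading `chartGrading` (`…S1aChartRingGrading`, p577360) and the lifted automorphism `sigmaChart`
(`…S1aChartRingSigma`) is again a tame node at `p`: Noetherian + regular (`…S1aChartRingNode`, from H3a p567753),
(T1), (T2), `σʼ` graded, `σʼ^[p] = id`. Together with the PINS of those files (`algebraMap_mk_mem_chartGrading`,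
`sigmaChart_algebraMap_algebraMap`, `sigmaChart_s`) this is `ChartClause` for normalised cover elements, and with
`chartGrading_zero_eq_coarseChart` + `coarseChartEquiv` (p575582) the degree-`0` part of the new node is the affine
blow-up chart `𝒜₀[K d/b]`.
-/

set_option linter.dupNamespace false

noncomputable section

open DirectSum Literature.AlgebraicGeometry.Resolution
open scoped LaurentPolynomial
open Summit.ResolutionOfSingularities.ResolutionOfSingularities.Theorems.WildQuotientResolution.S1.GradedLocalization
open Summit.ResolutionOfSingularities.ResolutionOfSingularities.Theorems.WildQuotientResolution.S1.ReesBigrading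
open Summit.ResolutionOfSingularities.ResolutionOfSingularities.Theorems.WildQuotientResolution.S1.ProducerStep

namespace Summit.ResolutionOfSingularities.ResolutionOfSingularities.Theorems.WildQuotientResolution.S1.CoarseChart

universe u v

variable {ι : Type v} [AddCommGroup ι] [DecidableEq ι] {B : Type u} [CommRing B]
  (𝒜 : ι → AddSubgroup B) [GradedRing 𝒜] {c : ℕ} (f : Fin c → B) {δ : Fin c → ι} (w : Fin c → ℕ)
  (hf : ∀ i, f i ∈ 𝒜 (δ i)) (d : ℕ) (b : ↥(𝒜 0)) (hb : b ∈ (traceFiltration 𝒜 f w).ideal d)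
  (σ : B ≃+* B)
  (hσJ : ∀ n : ℕ, ((weightedFiltration f w).ideal n).map (σ : B →+* B) ≤ (weightedFiltration f w).ideal n)
  {p : ℕ} (hp : 0 < p) (hσp : ∀ x : B, (⇑σ)^[p] x = x) (hσb : σ (b : B) = b)

/-- **The chart ring of a σ-invariant normalised cover element is a TAME NODE** (chart half of H3ʼs one-node producer
step, in the form consumed by H4c `BlowupNodeAtlas`). [OURS · L1 W4.5c] -/
theorem chartRing_isTameNode (hnode : IsTameNode p B 𝒜 σ) (hw : ∀ i, 0 < w i)
    (hK1 : RingTheory.Sequence.IsRegular B (List.ofFn f))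
    (hK1' : IsRegularRing (B ⧸ Ideal.span (Set.range f))) (hd : 0 < d) :
    @IsTameNode p (ℤ × ι) _ _ (ChartRing 𝒜 f w d b hb) _ (chartGrading 𝒜 f w hf d b hb)
      (chartGradedRing 𝒜 f w hf d b hb) (sigmaChart 𝒜 f w d b hb σ hσJ hp hσp hσb) := by
  obtain ⟨_, hR, hT1, hT2, hσ𝒜, -⟩ := hnode
  letI := chartGradedRing 𝒜 f w hf d b hb
  haveI := hR
  obtain ⟨hN', hR'⟩ := chartRing_isNoetherianRing_isRegularRing 𝒜 f w d b hb hw hK1 hK1'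
  exact ⟨hN', hR', chartRing_T1 𝒜 f w hf d b hb hd hT1, chartRing_T2 𝒜 f w hf d b hb hT2,
    fun e y hy => sigmaChart_mem_chartGrading 𝒜 f w hf d b hb σ hσJ hp hσp hσb
      (fun i x hx => hσ𝒜 i x hx) e y hy,
    sigmaChart_iterate 𝒜 f w d b hb σ hσJ hp hσp hσb⟩

end Summit.ResolutionOfSingularities.ResolutionOfSingularities.Theorems.WildQuotientResolution.S1.CoarseChart

end
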